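import Summits.AtomisticToContinuum.HydrodynamicLimit.Theorems.TwoClocksEquilibriumFastWindowLDStubBookkeeping
import Summits.AtomisticToContinuum.HydrodynamicLimit.Theorems.TwoClocksEquilibriumFastWindowLDStubOneSiteGauss
import Summits.AtomisticToContinuum.HydrodynamicLimit.Theorems.TwoClocksEquilibriumFastWindowLDStubStaticReduction
import Summits.AtomisticToContinuum.HydrodynamicLimit.Theses.TwoClocks

/-!
# `EquilibriumFastWindowLD` reduced to a uniform doubling gain (route TwoClocks, crux
# stmt-AtomisticToContinuum-14440; line `Sketch` = card static-seed-doubling-rg, composition)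

Helper file (`--supports stmt-AtomisticToContinuum-14440`) of the line lead. Write
`M_N(β, τ) := ∫⁻ exp(β Σᵢ w⁻¹∫₀ʷ F((Φ_N.flow r z)ᵢ) dr) dG_N`, `w = τ (N+1)^{-1/3}`, for the window
exponential moment of the crux (global canonical Gibbs law `G_N = localGibbsLaw σ a₀ u₀ θ₀ N Φ_N` with
constant profiles, a continuous one-body `F` of quadratic growth orthogonal at every `x` to the
collision invariants). The three STATIC stubs of the line are landed theorems:

* `FastWindowRG.stub_bookkeeping` — the time-scale renormalisation: a quadratic static seed
  `M_N(β, τ) ≤ e^{Cβ²(N+1)}` at every window and the dyadic doubling inequalities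
  `M_N(β, 2T) ≤ e^{δ(N+1)} M_N(β/2, T)^{2(1+η)}` (`T = 2ʲτ₀`) with a UNIFORM gain `η < 1` give
  `∀ |β| ≤ β₀ ∀ ε > 0 ∃ τ ∃ N₀ ∀ N ≥ N₀, M_N(β, τ) ≤ e^{ε(N+1)}` (the free map `Λ ↦ 2Λ(·/2)` contracts
  quadratic germs; `q = 2(1+η) < 4` gives `Λ_{2ᵏτ₀}(β) ≤ Cβ²(q/4)ᵏ`);
* `FastWindowRG.stub_oneSiteGauss` — a centred one-body function of quadratic growth has one-site
  moment `≤ e^{Kt²}` under `N(u, θ id)` for `|t| ≤ t₀(C, θ, u)` (Taylor + Fernique);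
* `FastWindowRG.stub_staticReduction` — Jensen in time + invariance of `G_N` and the Gaussian
  one-site factorisation turn the one-site bound into the static seed, at every window and every `N`.

Hence (`EquilibriumFastWindowLD_of_doublingGain`) **the crux follows from its one dynamical input in
RG form**: at small density, for every fast `F`, a uniform doubling gain `η < 1` at all dyadic scales
above some `τ₀` for `|β| ≤ β₁` — in pressure terms `Λ_{2T}(β) ≤ 2(1+η)Λ_T(β/2)` for `T = 2ʲτ₀`, i.e.
doubling the window at halved tilt beats the exponent `4` by a fixed factor (exact independence of the
two half-windows is `η = 0`; the free Hölder bound `Λ_{2T} ≤ Λ_T` is `η = 1` and gives no decay). This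
hypothesis is the registered stub `stub_doublingGain` of the line's skeleton
(`Cruxes/EquilibriumFastWindowLD/Lines/Sketch.lean`); it is open (it is false for free flight, like
the crux, and no fixed-density long-kinetic-time decorrelation estimate at exponential scale is in
print: BGSS 2023 are Boltzmann–Grad and short-time / covariance-level). Nothing dynamical is proved
here.

References: S. Olla, S. R. S. Varadhan, H.-T. Yau, Comm. Math. Phys. 155 (1993) 523, §2
(exponential-moment currency); J.-D. Deuschel, D. W. Stroock, *Large Deviations* (1989) §5.4
(hypermixing: block decoupling at exponential scale); H. Spohn, *Large Scale Dynamics of Interacting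
Particles* (1991), Part I §2.3.

prover-line-stmt-AtomisticToContinuum-14440-0.
-/

noncomputable section

open MeasureTheory ProbabilityTheory Real Set Filter
open scoped ENNReal BigOperators

namespace Summit.AtomisticToContinuum.HydrodynamicLimit.Theorems.FastWindowRG

open Literature.Analysis.FluidPDE Literature.MathematicalPhysics.KineticTheory

/-- **`EquilibriumFastWindowLD` from a uniform doubling gain** (composition of the line `Sketch`,
card static-seed-doubling-rg). If at every small reduced density, for all constant profiles, every
family of hard-sphere flows and every fast one-body `F`, the window exponential moments satisfy the
dyadic doubling inequalities `M_N(β, 2T) ≤ e^{δ(N+1)} M_N(β/2, T)^{2(1+η)}` (`T = 2ʲτ₀`, all `j`, all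
`|β| ≤ β₁`, every slack `δ > 0`, eventually in `N`) with a uniform gain `η < 1`, then the crux holds:
universal `σ₀' = min σ₀ ½`; for a datum, `β₀ = min t₀ β₁` with `t₀` the one-site Gaussian range of
`stub_oneSiteGauss` for the growth constant of `F` (static seed by `stub_staticReduction`), and the
conclusion by `stub_bookkeeping` applied to `M β τ N := M_N(β, τ)`. [folklore] -/
theorem EquilibriumFastWindowLD_of_doublingGain :
    (∃ σ₀ : ℝ, 0 < σ₀ ∧ ∀ (a₀ θ₀ : ℝ) (u₀ : V3), 0 < a₀ → 0 < θ₀ → ∀ σ : ℝ, 0 < σ → σ < σ₀ →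
            ∀ Φ : (N : ℕ) → HardSphereFlow (Torus.geometry (Fin 3)) (hsDiameter σ N) (N + 1),
            ∀ F : T3 × V3 → ℝ, Continuous F → (∃ C : ℝ, ∀ y, |F y| ≤ C * (1 + ‖y.2‖ ^ 2)) →
            (∀ x, ∫ v, F (x, v) * localMaxwellian 1 θ₀ u₀ v = 0) →
            (∀ x (j : Fin 3), ∫ v, F (x, v) * v j * localMaxwellian 1 θ₀ u₀ v = 0) →
            (∀ x, ∫ v, F (x, v) * ‖v‖ ^ 2 * localMaxwellian 1 θ₀ u₀ v = 0) →
            ∃ β₁ : ℝ, 0 < β₁ ∧ ∃ τ₀ : ℝ, 0 < τ₀ ∧ ∃ η : ℝ, 0 ≤ η ∧ η < 1 ∧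
              ∀ j : ℕ, ∀ β : ℝ, |β| ≤ β₁ → ∀ δ : ℝ, 0 < δ → ∃ N₀ : ℕ, ∀ N : ℕ, N₀ ≤ N →
                ∫⁻ z, ENNReal.ofReal (Real.exp (β * ∑ i : Fin (N + 1),
                    (2 * (2 ^ j * τ₀) * ((N : ℝ) + 1) ^ (-(1 / 3 : ℝ)))⁻¹ *
                      ∫ r in (0 : ℝ)..(2 * (2 ^ j * τ₀) * ((N : ℝ) + 1) ^ (-(1 / 3 : ℝ))),
                        F (((Φ N).flow r z) i)))
                  ∂(localGibbsLaw σ (fun _ => a₀) (fun _ => u₀) (fun _ => θ₀) N (Φ N)) ≤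
                ENNReal.ofReal (Real.exp (δ * ((N : ℝ) + 1))) *
                  (∫⁻ z, ENNReal.ofReal (Real.exp (β / 2 * ∑ i : Fin (N + 1),
                      (2 ^ j * τ₀ * ((N : ℝ) + 1) ^ (-(1 / 3 : ℝ)))⁻¹ *
                        ∫ r in (0 : ℝ)..(2 ^ j * τ₀ * ((N : ℝ) + 1) ^ (-(1 / 3 : ℝ))),
                          F (((Φ N).flow r z) i)))
                    ∂(localGibbsLaw σ (fun _ => a₀) (fun _ => u₀) (fun _ => θ₀) N (Φ N))) ^
                    (2 * (1 + η))) →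
    Summit.AtomisticToContinuum.HydrodynamicLimit.Theses.TwoClocks.EquilibriumFastWindowLD := by
  intro h
  obtain ⟨σ₀, hσ₀, h4⟩ := h
  refine ⟨min σ₀ (1 / 2), lt_min hσ₀ (by norm_num), ?_⟩
  intro a₀ θ₀ u₀ ha hθ σ hσ hσlt Φ F hF hFC hF0 hF1 hF2
  have hσ₀' : σ < σ₀ := hσlt.trans_le (min_le_left _ _)
  have hσ2 : σ ≤ 1 / 2 := (hσlt.trans_le (min_le_right _ _)).le
  obtain ⟨C, hC⟩ := hFC
  -- the growth constant may be taken nonnegative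
  have hC' : ∀ y, |F y| ≤ max C 0 * (1 + ‖y.2‖ ^ 2) := fun y =>
    (hC y).trans (mul_le_mul_of_nonneg_right (le_max_left _ _) (by positivity))
  -- S4: the doubling gain for this datum
  obtain ⟨β₁, hβ₁, τ₀, hτ₀, η, hη0, hη1, hdbl⟩ :=
    h4 a₀ θ₀ u₀ ha hθ σ hσ hσ₀' Φ F hF ⟨C, hC⟩ hF0 hF1 hF2
  -- S2: the one-site Gaussian range and constant for the growth constant `max C 0`
  obtain ⟨t₀, ht₀, K, hK, hone⟩ := stub_oneSiteGauss hθ u₀ (le_max_right C 0)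
  have hone' : ∀ β : ℝ, |β| ≤ t₀ → ∀ x : T3,
      ∫⁻ v, ENNReal.ofReal (Real.exp (β * F (x, v))) ∂(gaussMeasure u₀ θ₀) ≤
        ENNReal.ofReal (Real.exp (K * β ^ 2)) := fun β hβ x =>
    hone (fun v => F (x, v)) (hF.measurable.comp (measurable_const.prodMk measurable_id))
      (fun v => hC' (x, v)) (hF0 x) β hβ
  -- the window moment of the crux, as an abstract function of (tilt, window parameter, N)
  set M : ℝ → ℝ → ℕ → ℝ≥0∞ := fun β τ N =>
    ∫⁻ z, ENNReal.ofReal (Real.exp (β * ∑ i : Fin (N + 1),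
        (τ * ((N : ℝ) + 1) ^ (-(1 / 3 : ℝ)))⁻¹ *
          ∫ r in (0 : ℝ)..(τ * ((N : ℝ) + 1) ^ (-(1 / 3 : ℝ))), F (((Φ N).flow r z) i)))
      ∂(localGibbsLaw σ (fun _ => a₀) (fun _ => u₀) (fun _ => θ₀) N (Φ N)) with hM
  -- S3: the static seed at every window, for |β| ≤ t₀
  have hseed : ∀ β : ℝ, |β| ≤ min t₀ β₁ → ∀ τ : ℝ, 0 < τ → ∀ N : ℕ,
      M β τ N ≤ ENNReal.ofReal (Real.exp (K * β ^ 2 * ((N : ℝ) + 1))) := by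
    intro β hβ τ hτ N
    simp only [hM]
    exact stub_staticReduction ha hθ u₀ hσ2 N (Φ N) hF (hone' β (hβ.trans (min_le_left _ _))) hτ
  have hdbl' : ∀ j : ℕ, ∀ β : ℝ, |β| ≤ min t₀ β₁ → ∀ δ : ℝ, 0 < δ → ∃ N₀ : ℕ, ∀ N : ℕ, N₀ ≤ N →
      M β (2 * (2 ^ j * τ₀)) N ≤
        ENNReal.ofReal (Real.exp (δ * ((N : ℝ) + 1))) * M (β / 2) (2 ^ j * τ₀) N ^ (2 * (1 + η)) := by
    intro j β hβ δ hδ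
    simp only [hM]
    exact hdbl j β (hβ.trans (min_le_right _ _)) δ hδ
  have hdecay := stub_bookkeeping M (lt_min ht₀ hβ₁) hK hτ₀ hη0 hη1 hseed hdbl'
  refine ⟨min t₀ β₁, lt_min ht₀ hβ₁, ?_⟩
  intro β hβ ε hε
  obtain ⟨τ, hτ, N₀, hN⟩ := hdecay β hβ ε hε
  refine ⟨τ, hτ, N₀, fun N hNN => ?_⟩
  have := hN N hNN
  simpa only [hM] using this

end Summit.AtomisticToContinuum.HydrodynamicLimit.Theorems.FastWindowRG

end
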